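import Summits.Ventures.Crystal3D.Theorems.StickyWulffConstantCoaxialWallLawJammedFrames
import HarnessLib

/-!
# ONE JAMMED BALL OVER A MODULE WINDOW, II: `x` is never an end ball, end pairs survive its removal, sharp pools, the comparison
# (crux `CoaxialWallLaw`, stmt-Ventures-19481, line `WallLedgerF`; census-free reduction step for the U-A1 stub `JammedOneSmall` of `…TailResidueDefsU`)

HONEST FRAMING. Venture `Summits/Ventures/Crystal3D` (cell `crystal3d-full`), helper `--supports` the crux `CoaxialWallLaw` of
`route-Ventures-StickyWulffConstant` (REGISTERED line `WallLedgerF`, skeleton 'CoaxialWallLawCertificates' v4; v5 texts `…TailResidueDefsU`).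
Rung credit only; F-C1 not moved; census-free.  Setting of `…JammedFrames` (model position, payer `0`; window balls other than `x` on the coaxial
module within `3` of the payer; `x ∈ Y` off the module, `≤ 3` contacts, not capping):
* `norm_dir_eq_one`; **`isEndMove_erase_jammed`** — an end move of a reader `q ≠ x` onto `b ≠ x` survives the removal of `x` (every ball it
  reads and every far slot of its target is a module point, `…JammedFrames`);
* **`not_isEndPairA_jammed`** — `x` is never an end ball (a straight target `q + d` and a cross target `q − M_m d` are module points);
* **`isEndPairA_erase_jammed`**, `endMultA_le_erase_jammed`, `endMultA_eq_zero_jammed` — (A)-end pairs of balls `b ≠ x` within `1` of the payer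
  survive, so their multiplicities only grow when `x` is removed (the two-payer clause as in `…JammedBall`);
* **`pooledDef_erase_le_sharp`** — `pooledDef (Y.erase x) b + [dist b x ≤ 1]·(12 − deg x) ≤ pooledDef Y b + #{y ∈ Y ∖ x : dist x y = 1, dist b y ≤ 1}`
  (the landed `pooledDef_erase_le` dropped `x`'s own deficiency `≥ 9` from the pools of its contacts);
* **`localSummandA_le_of_jammed_module`** — `Σ_A(Y, 0) ≤ Σ_b e'(b) / (p'(b) − c(b) + 9·[dist b x ≤ 1])` over the ON-SITE window `Y.erase x`,
  `c(b) ≤ 3` the number of contacts of `x` within `1` of `b`: the U-A1 certificate is a re-evaluation of on-site windows (next file: transport,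
  signature domination, the finite census `JammedOneCensus`).
WHAT THIS IS NOT: not the census, not the stub; F-C1 not moved.
-/

noncomputable section

namespace Summit.Ventures.Crystal3D.Theorems

namespace TailResidue

open Summit.Ventures.Crystal3D Finset
open Literature.MathematicalPhysics.StatisticalMechanics (basalMirror)
open scoped InnerProductSpace

/-! ### End pairs: `x` is never an end ball, and end pairs of other balls survive the removal of `x` -/

section Transfer

variable {Y : Finset (EuclideanSpace ℝ (Fin 3))} {x : EuclideanSpace ℝ (Fin 3)} {v : WordVersion} {S₁ S₂ : PlateSystem}
  (hY : ∀ p ∈ Y, ∀ q ∈ Y, p ≠ q → 1 ≤ dist p q)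
  (h₁ : S₁.RT ⊆ fccSlots) (h₂ : S₂.RT ⊆ fccSlots)
  (hmod : ∀ y ∈ Y, dist (0 : EuclideanSpace ℝ (Fin 3)) y ≤ 3 → y ≠ x → y ∈ coaxialModule 1 (Real.sqrt (2 / 3)))
  (hxoff : x ∉ coaxialModule 1 (Real.sqrt (2 / 3)))
  (hfew : (Y.filter fun q => dist x q = 1).card ≤ 3)
  (hcap : ∀ t₁ ∈ Y, ∀ t₂ ∈ Y, ∀ t₃ ∈ Y, dist t₁ t₂ = 1 → dist t₁ t₃ = 1 → dist t₂ t₃ = 1 →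
    dist x t₁ = 1 → dist x t₂ = 1 → dist x t₃ = 1 → False)

/-- The direction of an admissible class is a unit vector (slot roots). -/
theorem norm_dir_eq_one (h₁ : S₁.RT ⊆ fccSlots) (h₂ : S₂.RT ⊆ fccSlots)
    {G : EuclideanSpace ℝ (Fin 3) ≃ₗᵢ[ℝ] EuclideanSpace ℝ (Fin 3)} {d : EuclideanSpace ℝ (Fin 3)}
    (hadm : S₁.Adm G d ∨ S₂.Adm G d) : ‖d‖ = 1 := by
  obtain ⟨w₀, hw₀, hdw⟩ : ∃ w₀ ∈ fccSlots, d = G w₀ := by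
    rcases hadm with h | h
    · exact (exists_slots_of_adm h₁ h).1
    · exact (exists_slots_of_adm h₂ h).1
  rw [hdw, LinearIsometryEquiv.norm_map]; exact norm_eq_one_of_mem_fccSlots hw₀

include hmod hxoff hcap in
/-- **`IsEndMove` survives the removal of `x`** at a reader `q ≠ x` within `2` of the payer and a target `b ≠ x` within `3` (module points). -/
theorem isEndMove_erase_jammed {G : EuclideanSpace ℝ (Fin 3) ≃ₗᵢ[ℝ] EuclideanSpace ℝ (Fin 3)} {d q b : EuclideanSpace ℝ (Fin 3)}
    (hq : q ∈ Y) (hqx : q ≠ x) (hq2 : dist (0 : EuclideanSpace ℝ (Fin 3)) q ≤ 2)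
    (hbY : b ∈ Y) (hbx : b ≠ x) (hb3 : dist (0 : EuclideanSpace ℝ (Fin 3)) b ≤ 3)
    (h : IsEndMove Y v G d q b) : IsEndMove (Y.erase x) v G d q b := by
  have hG := slots_mem_module_of_reader hmod hcap hq hqx hq2 h
  have hqM : q ∈ coaxialModule 1 (Real.sqrt (2 / 3)) := hmod q hq (by linarith) hqx
  have hbM : b ∈ coaxialModule 1 (Real.sqrt (2 / 3)) := hmod b hbY hb3 hbx
  have hsq : ∀ w ∈ fccSlots, q + G w ∈ Y → q + G w ∈ Y.erase x :=
    fun w hw hmem => mem_erase.2 ⟨ne_of_mem_module hxoff (add_mem_module hqM (hG w hw)), hmem⟩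
  have hsb : ∀ w ∈ fccSlots, b + G w ∈ Y → b + G w ∈ Y.erase x :=
    fun w hw hmem => mem_erase.2 ⟨ne_of_mem_module hxoff (add_mem_module hbM (hG w hw)), hmem⟩
  have hmq : ∀ m, IsTwinReading Y G m q → ∀ w ∈ fccSlots, q + (G w - (2 * ⟪G w, m⟫_ℝ) • m) ∈ Y →
      q + (G w - (2 * ⟪G w, m⟫_ℝ) • m) ∈ Y.erase x :=
    fun m htw w hw hmem => mem_erase.2
      ⟨ne_of_mem_module hxoff (add_mem_module hqM (mirror_mem_module_of_twinReading hmod hcap hq hqx hq2 htw hG w hw)), hmem⟩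
  have hmb : ∀ m, IsTwinReading Y G m q → ∀ w ∈ fccSlots, b + (G w - (2 * ⟪G w, m⟫_ℝ) • m) ∈ Y →
      b + (G w - (2 * ⟪G w, m⟫_ℝ) • m) ∈ Y.erase x :=
    fun m htw w hw hmem => mem_erase.2
      ⟨ne_of_mem_module hxoff (add_mem_module hbM (mirror_mem_module_of_twinReading hmod hcap hq hqx hq2 htw hG w hw)), hmem⟩
  have hEY : Y.erase x ⊆ Y := erase_subset x Y
  rcases h with ⟨hrd, hb, hnm⟩ | ⟨m, htw, hdm, hb, hnm⟩
  · refine Or.inl ⟨?_, hb, fun hmov => hnm (isMoving_of_subset hEY hsb hmov)⟩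
    rcases hrd with hf | ⟨hv, hn⟩ | ⟨m, htw, hdm⟩
    · exact Or.inl (isFull_of_exact hf hsq)
    · exact Or.inr (Or.inl ⟨hv, isNarrow_of_exact hn hsq fun _ => by rw [← hb]; exact mem_erase.2 ⟨hbx, hbY⟩⟩)
    · exact Or.inr (Or.inr ⟨m, isTwinReading_of_exact hEY htw hsq (hmq m htw), hdm⟩)
  · refine Or.inr ⟨m, isTwinReading_of_exact hEY htw hsq (hmq m htw), hdm, hb, fun hmov => hnm (isMoving_of_subset hEY ?_ hmov)⟩
    intro w hw hmem
    have e : (G.trans (ℝ ∙ m)ᗮ.reflection) w = G w - (2 * ⟪G w, m⟫_ℝ) • m := by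
      rw [LinearIsometryEquiv.trans_apply, reflection_unit_apply htw.1.1]
    rw [e] at hmem ⊢
    exact hmb m htw w hw hmem

include h₁ h₂ hmod hxoff hcap in
/-- **`x` IS NEVER AN END BALL** (when within `1` of the payer): no (A)-end pair of the jammed window has target `x`. -/
theorem not_isEndPairA_jammed (hx1 : dist (0 : EuclideanSpace ℝ (Fin 3)) x ≤ 1) (q : EuclideanSpace ℝ (Fin 3)) :
    ¬ IsEndPairA Y v S₁ S₂ x q := by
  rintro ⟨hq, -, -, G, d, hadm, -, hmove⟩
  have hd1 : ‖d‖ = 1 := norm_dir_eq_one h₁ h₂ hadm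
  obtain ⟨w₀, hw₀, hdw⟩ : ∃ w₀ ∈ fccSlots, d = G w₀ := by
    rcases hadm with h | h
    · exact (exists_slots_of_adm h₁ h).1
    · exact (exists_slots_of_adm h₂ h).1
  have hxq : dist x q = 1 := dist_eq_one_of_isEndMove hd1 hmove
  have hqx : q ≠ x := fun h => by rw [h, dist_self] at hxq; exact one_ne_zero hxq.symm
  have hq2 : dist (0 : EuclideanSpace ℝ (Fin 3)) q ≤ 2 := by linarith [dist_triangle (0 : EuclideanSpace ℝ (Fin 3)) x q]
  have hG := slots_mem_module_of_reader hmod hcap hq hqx hq2 hmove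
  have hqM : q ∈ coaxialModule 1 (Real.sqrt (2 / 3)) := hmod q hq (by linarith) hqx
  rcases hmove with ⟨-, hb, -⟩ | ⟨m, htw, -, hb, -⟩
  · exact hxoff (by rw [hb, hdw]; exact add_mem_module hqM (hG w₀ hw₀))
  · refine hxoff ?_
    rw [hb, hdw]
    exact sub_mem_module hqM (mirror_mem_module_of_twinReading hmod hcap hq hqx hq2 htw hG w₀ hw₀)

include hY h₁ h₂ hmod hxoff hfew hcap in
/-- **An (A)-end pair of a ball `b ≠ x` within `1` of the payer survives the removal of `x`.** -/
theorem isEndPairA_erase_jammed {b q : EuclideanSpace ℝ (Fin 3)} (hbx : b ≠ x) (hb1 : dist (0 : EuclideanSpace ℝ (Fin 3)) b ≤ 1)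
    (h : IsEndPairA Y v S₁ S₂ b q) : IsEndPairA (Y.erase x) v S₁ S₂ b q := by
  have hqx : q ≠ x := fun hq => not_isEndPairA_of_card_contacts_le_three (v := v) h₁ h₂ hfew b (hq ▸ h)
  obtain ⟨hq, hb, hpay, G, d, hadm, hpred, hmove⟩ := h
  have hd1 : ‖d‖ = 1 := norm_dir_eq_one h₁ h₂ hadm
  have hbq : dist b q = 1 := dist_eq_one_of_isEndMove hd1 hmove
  have hq2 : dist (0 : EuclideanSpace ℝ (Fin 3)) q ≤ 2 := by linarith [dist_triangle (0 : EuclideanSpace ℝ (Fin 3)) b q]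
  have hG := slots_mem_module_of_reader hmod hcap hq hqx hq2 hmove
  have hqM : q ∈ coaxialModule 1 (Real.sqrt (2 / 3)) := hmod q hq (by linarith) hqx
  have hbE : b ∈ Y.erase x := mem_erase.2 ⟨hbx, hb⟩
  refine ⟨mem_erase.2 ⟨hqx, hq⟩, hbE, ?_, G, d, hadm, ?_, isEndMove_erase_jammed hmod hxoff hcap hq hqx hq2 hb hbx (by linarith) hmove⟩
  · -- the two-payer clause survives: degrees only drop, and a ball touching `x` has degree `≤ 11` without it
    have hdeg : ∀ y, ((Y.erase x).filter fun q => dist y q = 1).card ≤ (Y.filter fun q => dist y q = 1).card :=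
      fun y => card_le_card (fun p hp => by rw [mem_filter] at hp ⊢; exact ⟨(mem_erase.1 hp.1).2, hp.2⟩)
    rcases hpay with hle | ⟨z₁, hz₁, z₂, hz₂, hne, hd₁, hd₂, hdeg₁, hdeg₂⟩
    · exact Or.inl ((hdeg b).trans hle)
    · by_cases hx₁ : z₁ = x
      · -- `x` touches `b`: in `Y.erase x` the ball `b` is deficient
        left
        subst hx₁
        have hxmem : z₁ ∈ Y.filter fun q => dist b q = 1 := mem_filter.2 ⟨hz₁, hd₁⟩
        have hsub : (Y.erase z₁).filter (fun q => dist b q = 1) ⊆ (Y.filter fun q => dist b q = 1).erase z₁ := by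
          intro p hp; rw [mem_filter] at hp; exact mem_erase.2 ⟨(mem_erase.1 hp.1).1, mem_filter.2 ⟨(mem_erase.1 hp.1).2, hp.2⟩⟩
        have h12 := card_filter_dist_eq_one_le_twelve Y hY b
        have hc := card_le_card hsub
        rw [card_erase_of_mem hxmem] at hc
        omega
      by_cases hx₂ : z₂ = x
      · left
        subst hx₂
        have hxmem : z₂ ∈ Y.filter fun q => dist b q = 1 := mem_filter.2 ⟨hz₂, hd₂⟩
        have hsub : (Y.erase z₂).filter (fun q => dist b q = 1) ⊆ (Y.filter fun q => dist b q = 1).erase z₂ := by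
          intro p hp; rw [mem_filter] at hp; exact mem_erase.2 ⟨(mem_erase.1 hp.1).1, mem_filter.2 ⟨(mem_erase.1 hp.1).2, hp.2⟩⟩
        have h12 := card_filter_dist_eq_one_le_twelve Y hY b
        have hc := card_le_card hsub
        rw [card_erase_of_mem hxmem] at hc
        omega
      · exact Or.inr ⟨z₁, mem_erase.2 ⟨hx₁, hz₁⟩, z₂, mem_erase.2 ⟨hx₂, hz₂⟩, hne, hd₁, hd₂, (hdeg z₁).trans hdeg₁, (hdeg z₂).trans hdeg₂⟩
  · -- the predecessor is a dozen position of `q`, hence a module point, hence not `x`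
    obtain ⟨w₀, hw₀, hdw⟩ : ∃ w₀ ∈ fccSlots, -d = G w₀ := by
      rcases hadm with h | h
      · exact (exists_slots_of_adm h₁ h).2
      · exact (exists_slots_of_adm h₂ h).2
    refine mem_erase.2 ⟨ne_of_mem_module hxoff ?_, hpred⟩
    rw [sub_eq_add_neg, hdw]
    exact add_mem_module hqM (hG w₀ hw₀)

end Transfer


/-! ### Multiplicities and pools -/

section Assembly

variable {Y : Finset (EuclideanSpace ℝ (Fin 3))} {x : EuclideanSpace ℝ (Fin 3)} {v : WordVersion} {S₁ S₂ : PlateSystem}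
  (hY : ∀ p ∈ Y, ∀ q ∈ Y, p ≠ q → 1 ≤ dist p q)
  (h₁ : S₁.RT ⊆ fccSlots) (h₂ : S₂.RT ⊆ fccSlots)
  (hmod : ∀ y ∈ Y, dist (0 : EuclideanSpace ℝ (Fin 3)) y ≤ 3 → y ≠ x → y ∈ coaxialModule 1 (Real.sqrt (2 / 3)))
  (hxoff : x ∉ coaxialModule 1 (Real.sqrt (2 / 3)))
  (hfew : (Y.filter fun q => dist x q = 1).card ≤ 3)
  (hcap : ∀ t₁ ∈ Y, ∀ t₂ ∈ Y, ∀ t₃ ∈ Y, dist t₁ t₂ = 1 → dist t₁ t₃ = 1 → dist t₂ t₃ = 1 →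
    dist x t₁ = 1 → dist x t₂ = 1 → dist x t₃ = 1 → False)

include hY h₁ h₂ hmod hxoff hfew hcap in
open scoped Classical in
/-- **End multiplicities of balls `b ≠ x` near the payer only grow when `x` is removed.** -/
theorem endMultA_le_erase_jammed {b : EuclideanSpace ℝ (Fin 3)} (hbx : b ≠ x) (hb1 : dist (0 : EuclideanSpace ℝ (Fin 3)) b ≤ 1) :
    endMultA Y v S₁ S₂ b ≤ endMultA (Y.erase x) v S₁ S₂ b := by
  unfold endMultA
  refine card_le_card fun q hq => ?_
  rw [mem_filter] at hq ⊢
  have hqx : q ≠ x := fun h => not_isEndPairA_of_card_contacts_le_three (v := v) h₁ h₂ hfew b (h ▸ hq.2)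
  exact ⟨mem_erase.2 ⟨hqx, hq.1⟩, isEndPairA_erase_jammed hY h₁ h₂ hmod hxoff hfew hcap hbx hb1 hq.2⟩

include h₁ h₂ hmod hxoff hcap in
open scoped Classical in
/-- **`x` is never read as an end ball**: `endMultA Y x = 0` when `x` is within `1` of the payer. -/
theorem endMultA_eq_zero_jammed (hx1 : dist (0 : EuclideanSpace ℝ (Fin 3)) x ≤ 1) : endMultA Y v S₁ S₂ x = 0 := by
  unfold endMultA
  rw [card_eq_zero, filter_eq_empty_iff]
  intro q _ h
  exact not_isEndPairA_jammed h₁ h₂ hmod hxoff hcap hx1 q h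

omit hfew in
include hY in
open scoped Classical in
/-- **POOLS, SHARP FORM.**  Removing `x` un-heals one unit at each of its contacts and removes `x`'s own deficiency from the pools containing it:
`pooledDef (Y.erase x) b + [dist b x ≤ 1]·(12 − deg x) ≤ pooledDef Y b + #{y ∈ Y ∖ x : dist x y = 1, dist b y ≤ 1}`. -/
theorem pooledDef_erase_le_sharp (hx : x ∈ Y) (hxdeg : (Y.filter fun q => dist x q = 1).card ≤ 11) (b : EuclideanSpace ℝ (Fin 3)) :
    pooledDef (Y.erase x) b +
        (if dist b x ≤ 1 then (12 : ℝ) - ((Y.filter fun q => dist x q = 1).card : ℝ) else 0) ≤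
      pooledDef Y b + (((Y.erase x).filter fun y => dist x y = 1 ∧ dist b y ≤ 1).card : ℝ) := by
  set P' := (Y.erase x).filter fun y => dist b y ≤ 1 ∧ ((Y.erase x).filter fun q => dist y q = 1).card ≤ 11 with hP'
  set f : EuclideanSpace ℝ (Fin 3) → ℝ := fun y =>
    if (Y.filter fun q => dist y q = 1).card ≤ 11 then (12 : ℝ) - ((Y.filter fun q => dist y q = 1).card : ℝ) else 0 with hf
  set g : EuclideanSpace ℝ (Fin 3) → ℝ := fun y => if dist x y = 1 then 1 else 0 with hg
  have hterm : ∀ y ∈ P', (12 : ℝ) - (((Y.erase x).filter fun q => dist y q = 1).card : ℝ) ≤ f y + g y := by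
    intro y hy
    obtain ⟨hyE, -, hdeg'⟩ := mem_filter.1 hy
    have hrel := card_contacts_erase (X := Y) (y := y) hx
    have h12 := card_filter_dist_eq_one_le_twelve Y hY y
    by_cases hxy : dist y x = 1
    · rw [if_pos hxy] at hrel
      have hxy' : dist x y = 1 := by rw [dist_comm]; exact hxy
      simp only [hf, hg, if_pos hxy']
      split_ifs with hle
      · have : ((Y.filter fun q => dist y q = 1).card : ℝ) = (((Y.erase x).filter fun q => dist y q = 1).card : ℝ) + 1 := by
          exact_mod_cast hrel
        linarith
      · have h11 : ((Y.erase x).filter fun q => dist y q = 1).card = 11 := by omega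
        rw [h11]; norm_num
    · rw [if_neg hxy, add_zero] at hrel
      have hxy' : ¬ dist x y = 1 := by rw [dist_comm]; exact hxy
      simp only [hf, hg, if_neg hxy', add_zero]
      rw [if_pos (by rw [hrel]; exact hdeg'), hrel]
  have hdef : pooledDef (Y.erase x) b = ∑ y ∈ P', ((12 : ℝ) - (((Y.erase x).filter fun q => dist y q = 1).card : ℝ)) := by
    unfold pooledDef; rfl
  have hsum : pooledDef (Y.erase x) b ≤ ∑ y ∈ P', f y + ∑ y ∈ P', g y := by
    rw [hdef, ← sum_add_distrib]; exact sum_le_sum hterm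
  have hfnn : ∀ y, 0 ≤ f y := fun y => by
    simp only [hf]; split_ifs with h
    · have : ((Y.filter fun q => dist y q = 1).card : ℝ) ≤ 11 := by exact_mod_cast h
      linarith
    · exact le_rfl
  -- the sharp comparison with the pool of `Y`: `x` itself is a pool member when `dist b x ≤ 1`
  set Q := Y.filter (fun y => dist b y ≤ 1 ∧ (Y.filter fun q => dist y q = 1).card ≤ 11) with hQ
  have hpool : pooledDef Y b = ∑ y ∈ Q, f y := by
    unfold pooledDef
    exact sum_congr rfl fun y hy => by simp only [hf, if_pos (mem_filter.1 hy).2.2]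
  have step : ∑ y ∈ P', f y ≤ ∑ y ∈ Q.erase x, f y := by
    calc ∑ y ∈ P', f y = ∑ y ∈ P'.filter (fun y => (Y.filter fun q => dist y q = 1).card ≤ 11), f y +
          ∑ y ∈ P'.filter (fun y => ¬ (Y.filter fun q => dist y q = 1).card ≤ 11), f y := (sum_filter_add_sum_filter_not _ _ _).symm
      _ = ∑ y ∈ P'.filter (fun y => (Y.filter fun q => dist y q = 1).card ≤ 11), f y := by
          rw [add_eq_left]
          exact sum_eq_zero fun y hy => by simp only [hf, if_neg (mem_filter.1 hy).2]
      _ ≤ ∑ y ∈ Q.erase x, f y := by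
          refine sum_le_sum_of_subset_of_nonneg (fun y hy => ?_) fun y _ _ => hfnn y
          obtain ⟨hyP, hle⟩ := mem_filter.1 hy
          obtain ⟨hyE, hby, -⟩ := mem_filter.1 hyP
          exact mem_erase.2 ⟨(mem_erase.1 hyE).1, mem_filter.2 ⟨(mem_erase.1 hyE).2, hby, hle⟩⟩
  have hf_le : ∑ y ∈ P', f y + (if dist b x ≤ 1 then (12 : ℝ) - ((Y.filter fun q => dist x q = 1).card : ℝ) else 0) ≤
      pooledDef Y b := by
    by_cases hbx1 : dist b x ≤ 1
    · have hxQ : x ∈ Q := mem_filter.2 ⟨hx, hbx1, hxdeg⟩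
      have hfx : f x = (12 : ℝ) - ((Y.filter fun q => dist x q = 1).card : ℝ) := by simp only [hf, if_pos hxdeg]
      rw [if_pos hbx1, hpool, ← sum_erase_add _ _ hxQ, hfx]
      linarith
    · rw [if_neg hbx1, add_zero, hpool]
      exact step.trans (sum_le_sum_of_subset_of_nonneg (erase_subset _ _) fun y _ _ => hfnn y)
  have hg_le : ∑ y ∈ P', g y ≤ (((Y.erase x).filter fun y => dist x y = 1 ∧ dist b y ≤ 1).card : ℝ) := by
    calc ∑ y ∈ P', g y = ((P'.filter fun y => dist x y = 1).card : ℝ) := by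
          simp only [hg]; rw [Finset.sum_boole]
      _ ≤ (((Y.erase x).filter fun y => dist x y = 1 ∧ dist b y ≤ 1).card : ℝ) := by
          exact_mod_cast card_le_card fun y hy => by
            obtain ⟨hyP, hxy⟩ := mem_filter.1 hy
            obtain ⟨hyE, hby, -⟩ := mem_filter.1 hyP
            exact mem_filter.2 ⟨hyE, hxy, hby⟩
  linarith

include hY h₁ h₂ hmod hxoff hfew hcap in
open scoped Classical in
/-- **THE JAMMED-BALL COMPARISON ON A MODULE WINDOW** (model position, payer `0`).  Write `e', p'` for the (A)-multiplicities and pools of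
`Y.erase x` and `c(b) = #{y ∈ Y ∖ x : dist x y = 1, dist b y ≤ 1}`.  If every lowered pool `p'(b) − c(b) + 9·[dist b x ≤ 1]` at a ball within
`1` of the payer is positive, then `Σ_A(Y, 0) ≤ Σ_b e'(b) / (p'(b) − c(b) + 9·[dist b x ≤ 1])`. -/
theorem localSummandA_le_of_jammed_module (hx : x ∈ Y)
    (hpos : ∀ b ∈ Y.erase x, dist (0 : EuclideanSpace ℝ (Fin 3)) b ≤ 1 →
      0 < pooledDef (Y.erase x) b - (((Y.erase x).filter fun y => dist x y = 1 ∧ dist b y ≤ 1).card : ℝ) +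
        (if dist b x ≤ 1 then (9 : ℝ) else 0)) :
    localSummandA v S₁ S₂ Y 0 ≤
      ∑ b ∈ (Y.erase x).filter (fun b => dist (0 : EuclideanSpace ℝ (Fin 3)) b ≤ 1 ∧ 0 < endMultA (Y.erase x) v S₁ S₂ b),
        (endMultA (Y.erase x) v S₁ S₂ b : ℝ) /
          (pooledDef (Y.erase x) b - (((Y.erase x).filter fun y => dist x y = 1 ∧ dist b y ≤ 1).card : ℝ) +
            (if dist b x ≤ 1 then (9 : ℝ) else 0)) := by
  unfold localSummandA
  have hxdeg : (Y.filter fun q => dist x q = 1).card ≤ 11 := hfew.trans (by norm_num)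
  have hnine : (9 : ℝ) ≤ (12 : ℝ) - ((Y.filter fun q => dist x q = 1).card : ℝ) := by
    have : ((Y.filter fun q => dist x q = 1).card : ℝ) ≤ 3 := by exact_mod_cast hfew
    linarith
  set A := Y.filter (fun b => dist (0 : EuclideanSpace ℝ (Fin 3)) b ≤ 1 ∧ 0 < endMultA Y v S₁ S₂ b) with hA
  set A' := (Y.erase x).filter (fun b => dist (0 : EuclideanSpace ℝ (Fin 3)) b ≤ 1 ∧ 0 < endMultA (Y.erase x) v S₁ S₂ b) with hA'
  set D : EuclideanSpace ℝ (Fin 3) → ℝ := fun b =>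
    pooledDef (Y.erase x) b - (((Y.erase x).filter fun y => dist x y = 1 ∧ dist b y ≤ 1).card : ℝ) +
      (if dist b x ≤ 1 then (9 : ℝ) else 0) with hD
  set g : EuclideanSpace ℝ (Fin 3) → ℝ := fun b => (endMultA (Y.erase x) v S₁ S₂ b : ℝ) / D b with hg
  have key : ∀ b ∈ A, b ∈ A' ∧ (endMultA Y v S₁ S₂ b : ℝ) / pooledDef Y b ≤ g b := by
    intro b hb
    obtain ⟨hbY, hb1, hepos⟩ := mem_filter.1 hb
    have hbx : b ≠ x := by
      rintro rfl
      have h0 := endMultA_eq_zero_jammed (v := v) h₁ h₂ hmod hxoff hcap hb1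
      omega
    have hbE : b ∈ Y.erase x := mem_erase.2 ⟨hbx, hbY⟩
    have hle := endMultA_le_erase_jammed hY h₁ h₂ hmod hxoff hfew hcap (v := v) hbx hb1
    have hp := pooledDef_erase_le_sharp hY hx hxdeg b
    have hDpos : 0 < D b := hpos b hbE hb1
    have hDle : D b ≤ pooledDef Y b := by
      simp only [hD]
      split_ifs with hbx1
      · rw [if_pos hbx1] at hp; linarith
      · rw [if_neg hbx1] at hp; linarith
    refine ⟨mem_filter.2 ⟨hbE, hb1, lt_of_lt_of_le hepos hle⟩, ?_⟩
    have hleR : (endMultA Y v S₁ S₂ b : ℝ) ≤ (endMultA (Y.erase x) v S₁ S₂ b : ℝ) := by exact_mod_cast hle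
    calc (endMultA Y v S₁ S₂ b : ℝ) / pooledDef Y b
        ≤ (endMultA (Y.erase x) v S₁ S₂ b : ℝ) / pooledDef Y b := div_le_div_of_nonneg_right hleR (hDpos.le.trans hDle)
      _ ≤ g b := div_le_div_of_nonneg_left (Nat.cast_nonneg _) hDpos hDle
  have hsub : A ⊆ A' := fun b hb => (key b hb).1
  have hgnn : ∀ b ∈ A', 0 ≤ g b := by
    intro b hb
    obtain ⟨hbE, hb1, -⟩ := mem_filter.1 hb
    exact div_nonneg (Nat.cast_nonneg _) (hpos b hbE hb1).le
  calc ∑ b ∈ A, (endMultA Y v S₁ S₂ b : ℝ) / pooledDef Y b ≤ ∑ b ∈ A, g b := sum_le_sum fun b hb => (key b hb).2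
    _ ≤ ∑ b ∈ A', g b := sum_le_sum_of_subset_of_nonneg hsub fun b hb _ => hgnn b hb

end Assembly

end TailResidue

end Summit.Ventures.Crystal3D.Theorems

end
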